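import Literature.AnabelianGeometry.SemiGraphs.PSCSeparatingCoveringsTwoComponentPointed
import Literature.AnabelianGeometry.SemiGraphs.PSCSeparatingCoveringsTwoComponentPointedEdges
import Literature.AnabelianGeometry.SemiGraphs.PSCTwoComponentAffinePointedOrigin
import HarnessLib

/-!
# [CombGC] Prop. 1.2 IN FULL and the separating coverings (rows F-2829, F-2830, F-0438, F-0459) at two-component data POINTED ON BOTH SIDES

Mochizuki, *A combinatorial version of the Grothendieck conjecture*, Tohoku Math. J. **59** (2007)
[CombGC], Proposition 1.2 (i)(ii) p. 8 and its PROOF p. 9 [cite: MochizukiCombGC2007, Prop 1.2 pp.8-9]: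
the separating-coverings step typed LEVEL-WISE as `PSCDatum.SeparatingCoverings` /
`SeparatingCoveringsHolds Ω` (abc-iut-w4-d081, row P12-L01; abc-iut FACT-LIST rows F-2829 / F-2830), and
the printed statements `OpenInterDeterminesComponentHolds Ω` (F-0459), `CommensurableTerminalityHolds Ω`
(F-0438) of abc-iut-L3-t4 — schemata whose universal closures are refuted as typed; the instance forms at
genuine carriers are the content.

PROOF-ONLY file (abc-iut-f-166 gen 6, row «ONE-CUSP-CORNERS» (1), file 3/3; 0 definitions).  CAPSTONE at
the data of two-component shape POINTED ON BOTH SIDES (`C₀ ∪_ν C₁`, `1 ≤ s ≤ r − 1` marked points on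
`C₁`, both components stable, genera pinned; gen 2's origin hypothesis of
`PSCTwoComponentAffinePointedOrigin.lean` / `PSCTwoComponentPointedProp12.lean` BY NAME) — in particular at
curves with a component carrying ONE marked point, the corner `min(s, r − s) = 1`:

* `separatingCoverings_of_twoComponentPointed` — **F-2829**, all three conjuncts (files 1/3, 2/3 and
  abc-iut-f-164's `unrRows_of_twoComponent`);
* `prop12_of_twoComponentPointed` — all five typed clauses of Prop. 1.2 (i)(ii) there (abc-iut-f-164's
  `openInterDeterminesComponent_of_twoComponentAffine'`, `commensurablyTerminal_of_twoComponentPointed`,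
  BY NAME; recorded next to F-2829 for the census);
* `twoComponentPointedOrigin_separatingCoveringsHolds` — **F-2830 at EVERY origin of such data**;
  `twoComponentPointedOrigin_prop12_rows` — F-2830 ∧ F-0459 ∧ F-0438 there;
* `exists_twoComponentPointedOrigin_prop12_rows` — NON-VACUITY at the corner itself: the origin of the data
  `Γ_{2,2}`, genera `(1,1)`, ONE marked point on EACH component, is inhabited for every nonempty set `Σ` of
  primes (abc-iut-f-164's `exists_twoComponentAffineDatum`) and carries all three rows.

With the affine files (`s ≥ 2`, `r − s ≥ 2`), gen 5's unmarked-`C₁` capstone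
(`PSCTwoComponentUnmarkedProp12All.lean`, `r ≥ 2` for F-2829/F-2830) and abc-iut-f-060's closed-surface
file, the two-component ONE-node data now carry F-2826–F-2830 at every stable `(g₀, g₁, s, r)` except the
edge rows at `s = 0, r = 1`.  Instance forms at data of the shape of genuine two-component curves:
consistency evidence for the typed schemata, not the printed theorem for all pointed stable curves.
Nothing here takes a side on [IUTchIII] Cor. 3.12.
-/

noncomputable section

namespace Literature.AnabelianGeometry.SemiGraphs

namespace PSCDatum

open scoped Pointwise
open Literature.GroupTheory.CombinatorialGroupTheory
open Literature.GroupTheory.CombinatorialGroupTheory.PuncturedSurfaceGroup (cuspInertia)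
open SemiGraphOfAnabelioids (IsProSigmaCompletion)

section Datum

variable {P : Type} [Group P] [TopologicalSpace P] [IsTopologicalGroup P]
variable [CompactSpace P] [TotallyDisconnectedSpace P] {Sigma : Set ℕ} {g r : ℕ}

/-! ### F-2829 and Prop. 1.2 in full -/

/-- **Row F-2829 `SeparatingCoverings` — all three conjuncts — at EVERY two-component datum pointed on both
sides** (`1 ≤ s ≤ r − 1`, both components stable, genera pinned; the `Π^unr`-conjunct is abc-iut-f-164's
`unrRows_of_twoComponent`). [cite: MochizukiCombGC2007, Prop 1.2 proof p.9] -/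
theorem separatingCoverings_of_twoComponentPointed (hne : Sigma.Nonempty)
    (hprime : ∀ p ∈ Sigma, p.Prime) (ι : PuncturedSurfaceGroup g r →* P)
    (hι : IsProSigmaCompletion Sigma ι) (G : PSCDatum P) {g₀ s : ℕ} (hg₀ : g₀ ≤ g) (hs : 1 ≤ s)
    (hsr : s + 1 ≤ r) (hst₀ : 1 ≤ g₀ ∨ 2 ≤ r - s) (hst₁ : 1 ≤ g - g₀ ∨ 2 ≤ s) (e : G.graph.C ≃ Fin r)
    (hC : ∀ c', G.cuspGp c' = ((cuspInertia (g := g) (e c')).map ι).topologicalClosure)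
    (v₀ v₁ : G.graph.V) (hV : ∀ w, w = v₀ ∨ w = v₁) (ε : PuncturedSurfaceGroup g r)
    (hε : ε = ((List.finRange r).map fun j : Fin r =>
          if s ≤ (j : ℕ) then PuncturedSurfaceGroup.c (g := g) j else 1).prod *
        ((List.finRange g).map fun i : Fin g => if (i : ℕ) < g₀ then
          PuncturedSurfaceGroup.a (r := r) i * PuncturedSurfaceGroup.b i *
            (PuncturedSurfaceGroup.a i)⁻¹ * (PuncturedSurfaceGroup.b i)⁻¹ else 1).prod)
    (hV₀ : G.vertGp v₀ = ((Subgroup.closure {x : PuncturedSurfaceGroup g r |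
        (∃ i : Fin g, (i : ℕ) < g₀ ∧ (x = PuncturedSurfaceGroup.a i ∨ x = PuncturedSurfaceGroup.b i)) ∨
        ∃ j : Fin r, s ≤ (j : ℕ) ∧ x = PuncturedSurfaceGroup.c j}).map ι).topologicalClosure)
    (hV₁ : G.vertGp v₁ = ((Subgroup.closure {x : PuncturedSurfaceGroup g r |
        (∃ i : Fin g, g₀ ≤ (i : ℕ) ∧ (x = PuncturedSurfaceGroup.a i ∨ x = PuncturedSurfaceGroup.b i)) ∨
        (∃ j : Fin r, (j : ℕ) < s ∧ x = PuncturedSurfaceGroup.c j) ∨ x = ε}).map ι).topologicalClosure)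
    (n₀ : G.graph.N) (hN : ∀ n, n = n₀)
    (hE : G.nodeGp n₀ = ((Subgroup.zpowers ε).map ι).topologicalClosure)
    (hgen₀ : G.genus v₀ = g₀) (hgen₁ : G.genus v₁ = g - g₀) :
    G.SeparatingCoverings :=
  ⟨G.verticialSeparatingCoverings_of_twoComponentPointed hne hprime ι hι hg₀ hs hsr hst₀ hst₁ v₀ v₁ hV ε hε
      hV₀ hV₁,
    G.edgeLikeSeparatingCoverings_of_twoComponentPointed hne hprime ι hι hg₀ hs hsr hst₀ hst₁ e hC ε hε n₀ hN
      hE,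
    (G.unrRows_of_twoComponent hne hprime ι hι e hC n₀ hN v₀ v₁ hV ε hε hV₀ hV₁ hE hgen₀ hgen₁).1⟩

/-- **[CombGC] Prop. 1.2 (i) and (ii) IN FULL — all five typed clauses — at EVERY two-component datum
pointed on both sides** (abc-iut-f-164's `openInterDeterminesComponent_of_twoComponentAffine'` and
`commensurablyTerminal_of_twoComponentPointed`, BY NAME; recorded next to F-2829 for the census).
[cite: MochizukiCombGC2007, Prop 1.2 p.8] -/
theorem prop12_of_twoComponentPointed [T2Space P] (hne : Sigma.Nonempty)
    (hprime : ∀ p ∈ Sigma, p.Prime) (ι : PuncturedSurfaceGroup g r →* P)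
    (hι : IsProSigmaCompletion Sigma ι) (G : PSCDatum P) {g₀ s : ℕ} (hg₀ : g₀ ≤ g) (hs : 1 ≤ s)
    (hsr : s + 1 ≤ r) (hst₀ : 1 ≤ g₀ ∨ 2 ≤ r - s) (hst₁ : 1 ≤ g - g₀ ∨ 2 ≤ s) (e : G.graph.C ≃ Fin r)
    (hC : ∀ c', G.cuspGp c' = ((cuspInertia (g := g) (e c')).map ι).topologicalClosure)
    (v₀ v₁ : G.graph.V) (hV : ∀ w, w = v₀ ∨ w = v₁) (ε : PuncturedSurfaceGroup g r)
    (hε : ε = ((List.finRange r).map fun j : Fin r =>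
          if s ≤ (j : ℕ) then PuncturedSurfaceGroup.c (g := g) j else 1).prod *
        ((List.finRange g).map fun i : Fin g => if (i : ℕ) < g₀ then
          PuncturedSurfaceGroup.a (r := r) i * PuncturedSurfaceGroup.b i *
            (PuncturedSurfaceGroup.a i)⁻¹ * (PuncturedSurfaceGroup.b i)⁻¹ else 1).prod)
    (hV₀ : G.vertGp v₀ = ((Subgroup.closure {x : PuncturedSurfaceGroup g r |
        (∃ i : Fin g, (i : ℕ) < g₀ ∧ (x = PuncturedSurfaceGroup.a i ∨ x = PuncturedSurfaceGroup.b i)) ∨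
        ∃ j : Fin r, s ≤ (j : ℕ) ∧ x = PuncturedSurfaceGroup.c j}).map ι).topologicalClosure)
    (hV₁ : G.vertGp v₁ = ((Subgroup.closure {x : PuncturedSurfaceGroup g r |
        (∃ i : Fin g, g₀ ≤ (i : ℕ) ∧ (x = PuncturedSurfaceGroup.a i ∨ x = PuncturedSurfaceGroup.b i)) ∨
        (∃ j : Fin r, (j : ℕ) < s ∧ x = PuncturedSurfaceGroup.c j) ∨ x = ε}).map ι).topologicalClosure)
    (n₀ : G.graph.N) (hN : ∀ n, n = n₀)
    (hE : G.nodeGp n₀ = ((Subgroup.zpowers ε).map ι).topologicalClosure)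
    (hgen₀ : G.genus v₀ = g₀) (hgen₁ : G.genus v₁ = g - g₀) :
    (G.VerticialOpenInterDeterminesVertex ∧ G.EdgeLikeOpenInterDeterminesEdge ∧
      G.UnrVerticialOpenInterDeterminesVertex) ∧
      G.VerticialEdgeLikeCommensurablyTerminal ∧ G.UnrVerticialCommensurablyTerminal := by
  have hhyp : PuncturedSurfaceGroup.IsHyperbolicType g r := by
    unfold PuncturedSurfaceGroup.IsHyperbolicType
    rcases hst₀ with h | h <;> rcases hst₁ with h' | h' <;> omega
  exact ⟨G.openInterDeterminesComponent_of_twoComponentAffine' hne hprime ι hι hg₀ hs hsr hst₀ hst₁ e hC v₀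
      v₁ hV ε hε hV₀ hV₁ n₀ hN hE hgen₀ hgen₁,
    G.commensurablyTerminal_of_twoComponentPointed hne hprime ι hι hs hsr hhyp e hC v₀ v₁ hV ε hε hV₀ hV₁
      n₀ hN hE hgen₀ hgen₁⟩

end Datum

/-! ### Origin level: F-2830 (and the Prop. 1.2 rows) at every origin of two-component data pointed on both sides -/

/-- **Row F-2830 `SeparatingCoveringsHolds Ω` at EVERY origin whose data are of two-component shape pointed
on both sides** — gen 2's origin hypothesis of `PSCTwoComponentAffinePointedOrigin.lean` /
`PSCTwoComponentPointedProp12.lean` BY NAME (`1 ≤ s ≤ r − 1`, stability side conditions, any genera;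
profinite `Π` in `Type`): in particular at origins of curves with a component carrying ONE marked point.
[cite: MochizukiCombGC2007, Prop 1.2 proof p.9] -/
theorem twoComponentPointedOrigin_separatingCoveringsHolds (Ω : PSCOrigin.{0})
    (hΩ : ∀ ⦃Q : Type⦄ [Group Q] [TopologicalSpace Q] [IsTopologicalGroup Q] (G : PSCDatum Q),
      Ω.IsOfPSCType G → CompactSpace Q ∧ T2Space Q ∧ TotallyDisconnectedSpace Q ∧
        ∃ (S : Set ℕ) (g r g₀ s : ℕ) (ι : PuncturedSurfaceGroup g r →* Q) (e : G.graph.C ≃ Fin r)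
          (v₀ v₁ : G.graph.V) (n₀ : G.graph.N) (ε : PuncturedSurfaceGroup g r),
          S.Nonempty ∧ (∀ p ∈ S, p.Prime) ∧ IsProSigmaCompletion S ι ∧ g₀ ≤ g ∧ 1 ≤ s ∧ s + 1 ≤ r ∧
          (1 ≤ g₀ ∨ 2 ≤ r - s) ∧ (1 ≤ g - g₀ ∨ 2 ≤ s) ∧
          (∀ c, G.cuspGp c =
            ((PuncturedSurfaceGroup.cuspInertia (g := g) (e c)).map ι).topologicalClosure) ∧
          (∀ w, w = v₀ ∨ w = v₁) ∧ (∀ n, n = n₀) ∧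
          ε = ((List.finRange r).map fun j : Fin r =>
            if s ≤ (j : ℕ) then PuncturedSurfaceGroup.c (g := g) j else 1).prod *
          ((List.finRange g).map fun i : Fin g => if (i : ℕ) < g₀ then
            PuncturedSurfaceGroup.a (r := r) i * PuncturedSurfaceGroup.b i *
              (PuncturedSurfaceGroup.a i)⁻¹ * (PuncturedSurfaceGroup.b i)⁻¹ else 1).prod ∧
          G.vertGp v₀ = ((Subgroup.closure {x : PuncturedSurfaceGroup g r |
            (∃ i : Fin g, (i : ℕ) < g₀ ∧ (x = PuncturedSurfaceGroup.a i ∨ x = PuncturedSurfaceGroup.b i)) ∨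
            ∃ j : Fin r, s ≤ (j : ℕ) ∧ x = PuncturedSurfaceGroup.c j}).map ι).topologicalClosure ∧
          G.vertGp v₁ = ((Subgroup.closure {x : PuncturedSurfaceGroup g r |
            (∃ i : Fin g, g₀ ≤ (i : ℕ) ∧ (x = PuncturedSurfaceGroup.a i ∨ x = PuncturedSurfaceGroup.b i)) ∨
            (∃ j : Fin r, (j : ℕ) < s ∧ x = PuncturedSurfaceGroup.c j) ∨ x = ε}).map ι).topologicalClosure ∧
          G.nodeGp n₀ = ((Subgroup.zpowers ε).map ι).topologicalClosure ∧
          G.genus v₀ = g₀ ∧ G.genus v₁ = g - g₀) :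
    SeparatingCoveringsHolds Ω := by
  intro Q _ _ _ G hG
  obtain ⟨hc, -, hd, S, g, r, g₀, s, ι, e, v₀, v₁, n₀, ε, hne, hprime, hι, hg₀, hs, hsr, hst₀, hst₁, hC,
    hV, hN, hε, hV₀, hV₁, hE, hgen₀, hgen₁⟩ := hΩ G hG
  haveI := hc
  haveI := hd
  exact G.separatingCoverings_of_twoComponentPointed hne hprime ι hι hg₀ hs hsr hst₀ hst₁ e hC v₀ v₁ hV ε hε
    hV₀ hV₁ n₀ hN hE hgen₀ hgen₁

/-- **F-2830 ∧ F-0459 ∧ F-0438 at EVERY origin of two-component data pointed on both sides**: the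
separating-coverings statement as printed together with Prop. 1.2 (i) and (ii) as printed, datum-wise over
the origin. [cite: MochizukiCombGC2007, Prop 1.2 pp.8-9] -/
theorem twoComponentPointedOrigin_prop12_rows (Ω : PSCOrigin.{0})
    (hΩ : ∀ ⦃Q : Type⦄ [Group Q] [TopologicalSpace Q] [IsTopologicalGroup Q] (G : PSCDatum Q),
      Ω.IsOfPSCType G → CompactSpace Q ∧ T2Space Q ∧ TotallyDisconnectedSpace Q ∧
        ∃ (S : Set ℕ) (g r g₀ s : ℕ) (ι : PuncturedSurfaceGroup g r →* Q) (e : G.graph.C ≃ Fin r)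
          (v₀ v₁ : G.graph.V) (n₀ : G.graph.N) (ε : PuncturedSurfaceGroup g r),
          S.Nonempty ∧ (∀ p ∈ S, p.Prime) ∧ IsProSigmaCompletion S ι ∧ g₀ ≤ g ∧ 1 ≤ s ∧ s + 1 ≤ r ∧
          (1 ≤ g₀ ∨ 2 ≤ r - s) ∧ (1 ≤ g - g₀ ∨ 2 ≤ s) ∧
          (∀ c, G.cuspGp c =
            ((PuncturedSurfaceGroup.cuspInertia (g := g) (e c)).map ι).topologicalClosure) ∧
          (∀ w, w = v₀ ∨ w = v₁) ∧ (∀ n, n = n₀) ∧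
          ε = ((List.finRange r).map fun j : Fin r =>
            if s ≤ (j : ℕ) then PuncturedSurfaceGroup.c (g := g) j else 1).prod *
          ((List.finRange g).map fun i : Fin g => if (i : ℕ) < g₀ then
            PuncturedSurfaceGroup.a (r := r) i * PuncturedSurfaceGroup.b i *
              (PuncturedSurfaceGroup.a i)⁻¹ * (PuncturedSurfaceGroup.b i)⁻¹ else 1).prod ∧
          G.vertGp v₀ = ((Subgroup.closure {x : PuncturedSurfaceGroup g r |
            (∃ i : Fin g, (i : ℕ) < g₀ ∧ (x = PuncturedSurfaceGroup.a i ∨ x = PuncturedSurfaceGroup.b i)) ∨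
            ∃ j : Fin r, s ≤ (j : ℕ) ∧ x = PuncturedSurfaceGroup.c j}).map ι).topologicalClosure ∧
          G.vertGp v₁ = ((Subgroup.closure {x : PuncturedSurfaceGroup g r |
            (∃ i : Fin g, g₀ ≤ (i : ℕ) ∧ (x = PuncturedSurfaceGroup.a i ∨ x = PuncturedSurfaceGroup.b i)) ∨
            (∃ j : Fin r, (j : ℕ) < s ∧ x = PuncturedSurfaceGroup.c j) ∨ x = ε}).map ι).topologicalClosure ∧
          G.nodeGp n₀ = ((Subgroup.zpowers ε).map ι).topologicalClosure ∧
          G.genus v₀ = g₀ ∧ G.genus v₁ = g - g₀) :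
    SeparatingCoveringsHolds Ω ∧ OpenInterDeterminesComponentHolds Ω ∧ CommensurableTerminalityHolds Ω := by
  refine ⟨twoComponentPointedOrigin_separatingCoveringsHolds Ω hΩ, ?_, ?_⟩
  · intro Q _ _ _ G hG
    obtain ⟨hc, ht, hd, S, g, r, g₀, s, ι, e, v₀, v₁, n₀, ε, hne, hprime, hι, hg₀, hs, hsr, hst₀, hst₁, hC,
      hV, hN, hε, hV₀, hV₁, hE, hgen₀, hgen₁⟩ := hΩ G hG
    haveI := hc
    haveI := ht
    haveI := hd
    exact (G.prop12_of_twoComponentPointed hne hprime ι hι hg₀ hs hsr hst₀ hst₁ e hC v₀ v₁ hV ε hε hV₀ hV₁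
      n₀ hN hE hgen₀ hgen₁).1
  · intro Q _ _ _ G hG
    obtain ⟨hc, ht, hd, S, g, r, g₀, s, ι, e, v₀, v₁, n₀, ε, hne, hprime, hι, hg₀, hs, hsr, hst₀, hst₁, hC,
      hV, hN, hε, hV₀, hV₁, hE, hgen₀, hgen₁⟩ := hΩ G hG
    haveI := hc
    haveI := ht
    haveI := hd
    exact (G.prop12_of_twoComponentPointed hne hprime ι hι hg₀ hs hsr hst₀ hst₁ e hC v₀ v₁ hV ε hε hV₀ hV₁
      n₀ hN hE hgen₀ hgen₁).2

/-- **Non-vacuity at the corner: F-2830 ∧ F-0459 ∧ F-0438 at the INHABITED origin of the two-component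
data pointed on both sides with ONE marked point on each component** (`Γ_{2,2}`, genera `(1,1)`,
`s = 1 = r − s`; profinite pro-`Σ` completions in `Type`, any nonempty set `Σ` of primes).
[cite: MochizukiCombGC2007, Prop 1.2 pp.8-9] -/
theorem exists_twoComponentPointedOrigin_prop12_rows (Sigma : Set ℕ) (hne : Sigma.Nonempty)
    (hprime : ∀ p ∈ Sigma, p.Prime) :
    ∃ Ω : PSCOrigin.{0},
      (∃ (Q : ProfiniteGrp.{0}) (G : PSCDatum Q), Ω.IsOfPSCType G ∧ G.Sigma = Sigma ∧ G.graph.i = 2 ∧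
        G.graph.n = 1 ∧ G.graph.r = 2 ∧ ∀ v, G.genus v = 1) ∧
      SeparatingCoveringsHolds Ω ∧ OpenInterDeterminesComponentHolds Ω ∧
        CommensurableTerminalityHolds Ω := by
  classical
  let Ω : PSCOrigin.{0} :=
    ⟨fun {Q} _ _ G => ∃ (_ : IsTopologicalGroup Q), CompactSpace Q ∧ T2Space Q ∧
      TotallyDisconnectedSpace Q ∧
      ∃ (S : Set ℕ) (g r g₀ s : ℕ) (ι : PuncturedSurfaceGroup g r →* Q) (e : G.graph.C ≃ Fin r)
        (v₀ v₁ : G.graph.V) (n₀ : G.graph.N) (ε : PuncturedSurfaceGroup g r),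
        S.Nonempty ∧ (∀ p ∈ S, p.Prime) ∧ IsProSigmaCompletion S ι ∧ g₀ ≤ g ∧ 1 ≤ s ∧ s + 1 ≤ r ∧
        (1 ≤ g₀ ∨ 2 ≤ r - s) ∧ (1 ≤ g - g₀ ∨ 2 ≤ s) ∧
        (∀ c, G.cuspGp c =
          ((PuncturedSurfaceGroup.cuspInertia (g := g) (e c)).map ι).topologicalClosure) ∧
        (∀ w, w = v₀ ∨ w = v₁) ∧ (∀ n, n = n₀) ∧
        ε = ((List.finRange r).map fun j : Fin r =>
          if s ≤ (j : ℕ) then PuncturedSurfaceGroup.c (g := g) j else 1).prod *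
        ((List.finRange g).map fun i : Fin g => if (i : ℕ) < g₀ then
          PuncturedSurfaceGroup.a (r := r) i * PuncturedSurfaceGroup.b i *
            (PuncturedSurfaceGroup.a i)⁻¹ * (PuncturedSurfaceGroup.b i)⁻¹ else 1).prod ∧
        G.vertGp v₀ = ((Subgroup.closure {x : PuncturedSurfaceGroup g r |
          (∃ i : Fin g, (i : ℕ) < g₀ ∧ (x = PuncturedSurfaceGroup.a i ∨ x = PuncturedSurfaceGroup.b i)) ∨
          ∃ j : Fin r, s ≤ (j : ℕ) ∧ x = PuncturedSurfaceGroup.c j}).map ι).topologicalClosure ∧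
        G.vertGp v₁ = ((Subgroup.closure {x : PuncturedSurfaceGroup g r |
          (∃ i : Fin g, g₀ ≤ (i : ℕ) ∧ (x = PuncturedSurfaceGroup.a i ∨ x = PuncturedSurfaceGroup.b i)) ∨
          (∃ j : Fin r, (j : ℕ) < s ∧ x = PuncturedSurfaceGroup.c j) ∨ x = ε}).map ι).topologicalClosure ∧
        G.nodeGp n₀ = ((Subgroup.zpowers ε).map ι).topologicalClosure ∧
        G.genus v₀ = g₀ ∧ G.genus v₁ = g - g₀⟩
  have hΩ : ∀ ⦃Q : Type⦄ [Group Q] [TopologicalSpace Q] [IsTopologicalGroup Q] (G : PSCDatum Q),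
      Ω.IsOfPSCType G → CompactSpace Q ∧ T2Space Q ∧ TotallyDisconnectedSpace Q ∧
        ∃ (S : Set ℕ) (g r g₀ s : ℕ) (ι : PuncturedSurfaceGroup g r →* Q) (e : G.graph.C ≃ Fin r)
          (v₀ v₁ : G.graph.V) (n₀ : G.graph.N) (ε : PuncturedSurfaceGroup g r),
          S.Nonempty ∧ (∀ p ∈ S, p.Prime) ∧ IsProSigmaCompletion S ι ∧ g₀ ≤ g ∧ 1 ≤ s ∧ s + 1 ≤ r ∧
          (1 ≤ g₀ ∨ 2 ≤ r - s) ∧ (1 ≤ g - g₀ ∨ 2 ≤ s) ∧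
          (∀ c, G.cuspGp c =
            ((PuncturedSurfaceGroup.cuspInertia (g := g) (e c)).map ι).topologicalClosure) ∧
          (∀ w, w = v₀ ∨ w = v₁) ∧ (∀ n, n = n₀) ∧
          ε = ((List.finRange r).map fun j : Fin r =>
            if s ≤ (j : ℕ) then PuncturedSurfaceGroup.c (g := g) j else 1).prod *
          ((List.finRange g).map fun i : Fin g => if (i : ℕ) < g₀ then
            PuncturedSurfaceGroup.a (r := r) i * PuncturedSurfaceGroup.b i *
              (PuncturedSurfaceGroup.a i)⁻¹ * (PuncturedSurfaceGroup.b i)⁻¹ else 1).prod ∧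
          G.vertGp v₀ = ((Subgroup.closure {x : PuncturedSurfaceGroup g r |
            (∃ i : Fin g, (i : ℕ) < g₀ ∧ (x = PuncturedSurfaceGroup.a i ∨ x = PuncturedSurfaceGroup.b i)) ∨
            ∃ j : Fin r, s ≤ (j : ℕ) ∧ x = PuncturedSurfaceGroup.c j}).map ι).topologicalClosure ∧
          G.vertGp v₁ = ((Subgroup.closure {x : PuncturedSurfaceGroup g r |
            (∃ i : Fin g, g₀ ≤ (i : ℕ) ∧ (x = PuncturedSurfaceGroup.a i ∨ x = PuncturedSurfaceGroup.b i)) ∨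
            (∃ j : Fin r, (j : ℕ) < s ∧ x = PuncturedSurfaceGroup.c j) ∨ x = ε}).map ι).topologicalClosure ∧
          G.nodeGp n₀ = ((Subgroup.zpowers ε).map ι).topologicalClosure ∧
          G.genus v₀ = g₀ ∧ G.genus v₁ = g - g₀ := by
    intro Q _ _ _ G hG
    obtain ⟨_, h⟩ := hG
    exact h
  refine ⟨Ω, ?_, twoComponentPointedOrigin_prop12_rows Ω hΩ⟩
  obtain ⟨Q, ι, G, e, v₀, v₁, n₀, ε, hι, hSg, hi, hn, hr, hC, hV, hN, hε, hV₀, hV₁, hE, hg₀, hg₁, -⟩ :=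
    exists_twoComponentAffineDatum Sigma hne hprime 2 2 1 1
  have hgen : ∀ v, G.genus v = 1 := fun v => by
    rcases hV v with rfl | rfl
    · exact hg₀
    · exact hg₁
  refine ⟨Q, G, ?_, hSg, hi, hn, hr, hgen⟩
  exact ⟨inferInstance, inferInstance, inferInstance, inferInstance, Sigma, 2, 2, 1, 1, ι, e, v₀, v₁, n₀, ε,
    hne, hprime, hι, by norm_num, le_rfl, le_rfl, Or.inl le_rfl, Or.inl le_rfl, hC, hV, hN, hε, hV₀, hV₁,
    hE, hg₀, hg₁⟩

end PSCDatum

end Literature.AnabelianGeometry.SemiGraphs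

end
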